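import Summits.Ventures.CertifiedManyBodySolver.Observables.BoxRowBraggCeilings
import HarnessLib

/-!
# The `3 × 3` spin box WORDS (`F_s3_stag`, `F_s3` of the controls menu) as operators, their `D₄`-orbit dictionary,
# and the rung-leaf shape of the Néel / uniform-magnetisation ceilings

HONEST FRAMING: first certified bounds on pairing observables; not a superconductivity verdict; every number certified
(two lineages + referee) or labelled float.  Cell hubbard-obs (D-0042 crew 1), seat hubbard-obs-p3 (CONTROLS), gen 2.
Zero compute; no certificate; no named fact; no `sorry`.  A CEILING on a Bragg weight says nothing about the presence
of order.

Companion of `Observables/BoxRowBraggCeilings.lean` (theorem-only).  This file carries the DEFINITIONS a certificate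
typer needs to name the approved control row (lead rulings (ss2)/(ao3); HOME/hubbard-obs-p3/TARGET.md §3 C2.3′/C2.4,
menus/composite_box_rows.json):

* §0 (theorems) the `D₄`-symmetrised `3 × 2 ⊕ 2 × 3` Fejér box — the FALLBACK that needs no `(2,2)` word (the rung-0a `4 × 3` menu
  of record stops at `|r|₁ ≤ 3`): `μ((π,π)+2πℤ²) ≤ (6·c(0,0) − 14·c(1,0) + 8·c(1,1) + 4·c(2,0) − 4·c(2,1))/36` for `D₄`-invariant `C`
  (`braggWeight_pi_le_box32sym`, `neel_braggWeight_le_box32sym`);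
* `box3ClassSupport = {0, (1,0), (1,1), (2,0), (2,1), (2,2)} ⊆ ℤ²` — the origin and one representative per `D₄` class of
  displacement of the `3 × 3` box;
* `spinBoxStag3Word` — the objective WORD of the `(π,π)` staggered box row WITHOUT its constant:
  `−(1/6)·n_{0↑}n_{0↓} − (24/81)·𝐒₀·𝐒_{(1,0)} + (16/81)·𝐒₀·𝐒_{(1,1)} + (12/81)·𝐒₀·𝐒_{(2,0)} − (16/81)·𝐒₀·𝐒_{(2,1)}
  + (4/81)·𝐒₀·𝐒_{(2,2)}` (the `r = 0` class `(9/81)·𝐒₀·𝐒₀ = (9/81)·¾(n₀ − 2n_{0↑}n_{0↓})` contributes the constant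
  `7/96` at density `7/8` and the `docc` coefficient `−1/6`, exactly as the engine's menu folds it: `F_s3_stag = 7/96 +
  row·y`); `spinBox3Word` — the unsigned (`q = 0`) twin (`F_s3 = 7/96 + row·y`); `spinBox32StagWord` — the `3 × 2` fallback
  (`F_s32_stag = 7/64 + row·y`);
* the DICTIONARY `(1/8)Σ_γ Re ω(Γ(γ)·word) = class form` (`re_expect_d4_spinBoxStag3Word`, `boxStag3_classForm_le_of_orbitRow`,
  unsigned twins), for translation-invariant `ω` of density `7/8`;
* the ORBIT-ROW ⇒ CEILING theorems: a `D₄`-reduced certificate typed as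
  `M3CorrOrbitLowerRow t′ u r univ box3ClassSupport (−spinBoxStag3Word)` (the tree's only orbit predicate is LOWER, so an
  upper row on the word is a lower row on its negative, as rows #258–#263 were typed) plus the window node
  `M3EnergyUpperRow t′ u` give, for EVERY torus limit of unit `(rectN (7/8) L, S^z = 0)`-sector ground states of
  `hubbardTorusTT' L 1 t′ 8` and every finite measure representing `spinOrbitCorr ω`:
  `μ((π,π) + 2πℤ²) ≤ 7/96 − r` (`M3ObsNeelCeilingAt_of_spinBoxStag3_orbitRow`); unsigned: `μ(2πℤ²) ≤ 7/96 − r`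
  (`M3ObsUniformSpinCeilingAt_of_spinBox3_orbitRow`); `3 × 2` fallback: `μ((π,π) + 2πℤ²) ≤ 7/64 − r`
  (`M3ObsNeelCeilingAt_of_spinBox32Stag_orbitRow`);
* the LEAF shape `M3ObsNeelCeilingAt t′ c` / `M3ObsUniformSpinCeilingAt t′ c` (closed `Prop`s in the style of
  `Observables/RungLeaves.lean`: "every torus-limit ground state of the class has Néel (resp. uniform) Bragg weight ≤ c
  for every representing measure"), monotone in `c`, discharged by the orbit row (`…_of_spinBoxStag3_orbitRow`) and —
  for the record — ALREADY discharged at `c = 0.3399425` (`t′ = −1/4`, rows #259 + #93) and `c = 0.3360872` (`t′ = 0`,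
  rows #263 + #92) by the plaquette-kernel instances `neel_r259_instance` / `neel_r263_instance` (re-exported here, not
  re-proved).  The STEP-0 float preview of the box row is `≈ 0.27` at `t′ = −1/4` [float; no certificate yet].

References: Scalapino, Phys. Rep. 250 (1995) 329, §2; Hirsch, PRB 31 (1985) 4403, eq. (4.7).
-/

noncomputable section

open MeasureTheory Complex Filter Topology
open scoped Real BigOperators

namespace Summit.Ventures.CertifiedManyBodySolver.Observables

open Matrix Literature.MathematicalPhysics.QuantumLattice Literature.Probability.LatticeModels
open Literature.MathematicalPhysics.QuantumLattice.ThermodynamicLimit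
open HubbardWave0 Literature.MathematicalPhysics.QuantumManyBody.StateRelaxation
open Summit.HubbardSuperconductivity.ManyBodyBootstrap.Bounds
open Literature.MathematicalPhysics.QuantumLattice.FermionSpinMoment
open Summit.Ventures.CertifiedManyBodySolver.Certificates
open Summit.Ventures.CertifiedManyBodySolver.Transport
open Summit.Ventures.CertifiedManyBodySolver.SpinStarTL
open DihedralGroup

/-! ## §0  The `D₄`-symmetrised `3 × 2` Fejér box (needs no `(2,2)` word: the rung-0a `4 × 3` menu of record stops at `|r|₁ ≤ 3`) -/

section Box32

variable {C : Site 2 → ℂ} (μ : Measure (EuclideanSpace ℝ (Fin 2))) [IsFiniteMeasure μ]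

/-- **`3 × 2 ⊕ 2 × 3` staggered box ceiling.**  For a finite measure `μ` representing a `D₄`-invariant `C : ℤ² → ℂ`:
`μ((π,π) + 2πℤ²) ≤ (6·Re C(0,0) − 14·Re C(1,0) + 8·Re C(1,1) + 4·Re C(2,0) − 4·Re C(2,1))/36` — the mean of the `3 × 2` and
`2 × 3` box Fejér functionals (each `≥ 36·μ((π,π)+2πℤ²)` by `sq_card_mul_braggWeight_pi_le_sum_stag`); class weights = summed pair
counts `12, 28, 16, 8, 8` over `72`.  The fallback row `F_s32_stag` of the controls menu.  A CEILING. [cite: Scalapino1995, §2] -/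
theorem braggWeight_pi_le_box32sym
    (hμ : ∀ r : Site 2, ∫ ξ, exp ((∑ i, (r i : ℝ) * ξ i : ℝ) * I) ∂μ = C r)
    (hC : ∀ (γ : DihedralGroup 4) (v : Site 2), C (d4Vec γ v) = C v) :
    braggWeight μ ![![π, π]] ≤
      (6 * (C ![0, 0]).re - 14 * (C ![1, 0]).re + 8 * (C ![1, 1]).re + 4 * (C ![2, 0]).re - 4 * (C ![2, 1]).re) / 36 := by
  have h1 := sq_card_mul_braggWeight_pi_le_sum_stag μ hμ (Finset.range 3 ×ˢ Finset.range 2)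
    (fun mn : ℕ × ℕ => (![(mn.1 : ℤ), (mn.2 : ℤ)] : Site 2))
  have h2 := sq_card_mul_braggWeight_pi_le_sum_stag μ hμ (Finset.range 2 ×ˢ Finset.range 3)
    (fun mn : ℕ × ℕ => (![(mn.1 : ℤ), (mn.2 : ℤ)] : Site 2))
  have hQ : (fun _ : Fin 2 => π) = ![π, π] := by funext i; fin_cases i <;> rfl
  have hc1 : (((Finset.range 3 ×ˢ Finset.range 2).card : ℝ)) ^ 2 = 36 := by
    rw [Finset.card_product, Finset.card_range, Finset.card_range]; norm_num
  have hc2 : (((Finset.range 2 ×ˢ Finset.range 3).card : ℝ)) ^ 2 = 36 := by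
    rw [Finset.card_product, Finset.card_range, Finset.card_range]; norm_num
  rw [hQ, hc1] at h1
  rw [hQ, hc2] at h2
  simp only [Finset.sum_product, Finset.sum_range_succ, Finset.sum_range_zero, zero_add, Nat.cast_zero,
    Nat.cast_one, Nat.cast_ofNat, Matrix.cons_sub_cons, Matrix.empty_sub_empty, Fin.sum_univ_two,
    Matrix.cons_val_zero, Matrix.cons_val_one] at h1 h2
  norm_num at h1 h2
  obtain ⟨e1, e2, e3, e4, e5, e6, e7, e8, e9, e10, e11, e12, e13, e14, e15, e16, -, -, -⟩ :=
    d4Invariant_box3_values hC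
  simp only [e1, e2, e3, e4, e5, e6, e7, e8, e9, e10, e11, e12, e13, e14, e15, e16] at h1 h2
  rw [le_div_iff₀ (by norm_num : (0 : ℝ) < 36)]
  linarith

/-- State form: for every state `ω` and every finite measure representing `spinOrbitCorr ω`, the Néel weight is at most the
`D₄`-symmetrised `3 × 2` staggered box functional of `ω`.  A CEILING. [cite: Scalapino1995, §2] -/
theorem neel_braggWeight_le_box32sym (ω : InfVolFermionState 2)
    (hμ : ∀ r : Site 2, ∫ ξ, exp ((∑ i, (r i : ℝ) * ξ i : ℝ) * I) ∂μ = spinOrbitCorr ω r) :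
    braggWeight μ ![![π, π]] ≤
      (6 * (spinOrbitCorr ω ![0, 0]).re - 14 * (spinOrbitCorr ω ![1, 0]).re + 8 * (spinOrbitCorr ω ![1, 1]).re
        + 4 * (spinOrbitCorr ω ![2, 0]).re - 4 * (spinOrbitCorr ω ![2, 1]).re) / 36 :=
  braggWeight_pi_le_box32sym μ hμ (spinOrbitCorr_d4Vec ω)

end Box32

/-! ## §1  The support and the words -/

/-- The support `{0, (1,0), (1,1), (2,0), (2,1), (2,2)} ⊆ ℤ²`: the origin and one representative per `D₄` class of
displacement inside the `3 × 3` box. [cite: Scalapino1995, §2] -/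
abbrev box3ClassSupport : Finset (Site 2) := {0, ![1, 0], ![1, 1], ![2, 0], ![2, 1], ![2, 2]}

/-- `0 ∈ box3ClassSupport`. -/
theorem zero_mem_box3ClassSupport : (0 : Site 2) ∈ box3ClassSupport := Finset.mem_insert_self _ _
/-- `(1,0) ∈ box3ClassSupport`. -/
theorem r10_mem_box3ClassSupport : (![1, 0] : Site 2) ∈ box3ClassSupport := by decide
/-- `(1,1) ∈ box3ClassSupport`. -/
theorem r11_mem_box3ClassSupport : (![1, 1] : Site 2) ∈ box3ClassSupport := by decide
/-- `(2,0) ∈ box3ClassSupport`. -/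
theorem r20_mem_box3ClassSupport : (![2, 0] : Site 2) ∈ box3ClassSupport := by decide
/-- `(2,1) ∈ box3ClassSupport`. -/
theorem r21_mem_box3ClassSupport : (![2, 1] : Site 2) ∈ box3ClassSupport := by decide
/-- `(2,2) ∈ box3ClassSupport`. -/
theorem r22_mem_box3ClassSupport : (![2, 2] : Site 2) ∈ box3ClassSupport := by decide

/-- **The `(π,π)` staggered `3 × 3` spin box WORD** (the engine's `F_s3_stag` objective without its constant `7/96`):
`−(1/6)·n_{0↑}n_{0↓} − (24/81)·𝐒₀·𝐒_{(1,0)} + (16/81)·𝐒₀·𝐒_{(1,1)} + (12/81)·𝐒₀·𝐒_{(2,0)} − (16/81)·𝐒₀·𝐒_{(2,1)}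
+ (4/81)·𝐒₀·𝐒_{(2,2)}` — pair counts `9, 24, 16, 12, 16, 4` of the box per class, signs `(−1)^{|r|₁}`, the `r = 0` class
folded through `𝐒₀·𝐒₀ = ¾(n₀ − 2n_{0↑}n_{0↓})`. [cite: Scalapino1995, §2] -/
def spinBoxStag3Word : FermionOp box3ClassSupport :=
  ((-1/6 : ℚ) : ℂ) • (nAt 0 zero_mem_box3ClassSupport 0 * nAt 0 zero_mem_box3ClassSupport 1) +
  ((-24/81 : ℚ) : ℂ) • spinDotAt 0 zero_mem_box3ClassSupport ![1, 0] r10_mem_box3ClassSupport +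
  ((16/81 : ℚ) : ℂ) • spinDotAt 0 zero_mem_box3ClassSupport ![1, 1] r11_mem_box3ClassSupport +
  ((12/81 : ℚ) : ℂ) • spinDotAt 0 zero_mem_box3ClassSupport ![2, 0] r20_mem_box3ClassSupport +
  ((-16/81 : ℚ) : ℂ) • spinDotAt 0 zero_mem_box3ClassSupport ![2, 1] r21_mem_box3ClassSupport +
  ((4/81 : ℚ) : ℂ) • spinDotAt 0 zero_mem_box3ClassSupport ![2, 2] r22_mem_box3ClassSupport

/-- **The unsigned `3 × 3` spin box WORD** (the engine's `F_s3` objective without its constant `7/96`): all class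
weights positive, `−(1/6)·n_{0↑}n_{0↓} + (24/81)·𝐒₀·𝐒_{(1,0)} + … + (4/81)·𝐒₀·𝐒_{(2,2)}`. [cite: Scalapino1995, §2] -/
def spinBox3Word : FermionOp box3ClassSupport :=
  ((-1/6 : ℚ) : ℂ) • (nAt 0 zero_mem_box3ClassSupport 0 * nAt 0 zero_mem_box3ClassSupport 1) +
  ((24/81 : ℚ) : ℂ) • spinDotAt 0 zero_mem_box3ClassSupport ![1, 0] r10_mem_box3ClassSupport +
  ((16/81 : ℚ) : ℂ) • spinDotAt 0 zero_mem_box3ClassSupport ![1, 1] r11_mem_box3ClassSupport +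
  ((12/81 : ℚ) : ℂ) • spinDotAt 0 zero_mem_box3ClassSupport ![2, 0] r20_mem_box3ClassSupport +
  ((16/81 : ℚ) : ℂ) • spinDotAt 0 zero_mem_box3ClassSupport ![2, 1] r21_mem_box3ClassSupport +
  ((4/81 : ℚ) : ℂ) • spinDotAt 0 zero_mem_box3ClassSupport ![2, 2] r22_mem_box3ClassSupport

/-- **The `D₄`-symmetrised `3 × 2` staggered spin box WORD** (fallback `F_s32_stag` without its constant `7/64`; uses only the
classes `(1,0), (1,1), (2,0), (2,1)` of today's rung-0a menus): `−(1/4)·n_{0↑}n_{0↓} − (7/18)·𝐒₀·𝐒_{(1,0)} + (2/9)·𝐒₀·𝐒_{(1,1)}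
+ (1/9)·𝐒₀·𝐒_{(2,0)} − (1/9)·𝐒₀·𝐒_{(2,1)}` (= `(1/36)[−9·n↑n↓·… ]`: class counts `12, 28, 16, 8, 8` over `72`). [cite: Scalapino1995, §2] -/
def spinBox32StagWord : FermionOp box3ClassSupport :=
  ((-1/4 : ℚ) : ℂ) • (nAt 0 zero_mem_box3ClassSupport 0 * nAt 0 zero_mem_box3ClassSupport 1) +
  ((-7/18 : ℚ) : ℂ) • spinDotAt 0 zero_mem_box3ClassSupport ![1, 0] r10_mem_box3ClassSupport +
  ((2/9 : ℚ) : ℂ) • spinDotAt 0 zero_mem_box3ClassSupport ![1, 1] r11_mem_box3ClassSupport +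
  ((1/9 : ℚ) : ℂ) • spinDotAt 0 zero_mem_box3ClassSupport ![2, 0] r20_mem_box3ClassSupport +
  ((-1/9 : ℚ) : ℂ) • spinDotAt 0 zero_mem_box3ClassSupport ![2, 1] r21_mem_box3ClassSupport

/-! ## §2  The `D₄`-orbit dictionary -/

section Dictionary

variable {ω : InfVolFermionState 2}

/-- `Re ω(Γ(γ)·spinBoxStag3Word) = −(1/6)·docc − (24/81)·C_ω(γ(1,0)) + (16/81)·C_ω(γ(1,1)) + (12/81)·C_ω(γ(2,0))
− (16/81)·C_ω(γ(2,1)) + (4/81)·C_ω(γ(2,2))` for translation-invariant `ω` (`C_ω = spinCorr ω`). [folklore] -/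
theorem re_expect_d4_spinBoxStag3Word (hω : ω.IsTranslationInvariant) (g : DihedralGroup 4) :
    (ω.expect (d4ShiftSet g 0 box3ClassSupport)
        (fermionEmbed (PolySite.d4Emb g 0 box3ClassSupport) spinBoxStag3Word)).re =
      -(1/6) * docc ω - 24/81 * Certificates.spinCorr ω (d4Vec g ![1, 0])
        + 16/81 * Certificates.spinCorr ω (d4Vec g ![1, 1]) + 12/81 * Certificates.spinCorr ω (d4Vec g ![2, 0])
        - 16/81 * Certificates.spinCorr ω (d4Vec g ![2, 1]) + 4/81 * Certificates.spinCorr ω (d4Vec g ![2, 2]) := by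
  unfold spinBoxStag3Word
  simp only [spinDotAt, nAt, map_add, map_smul, map_mul, fermionEmbed_numberOp, fermionEmbed_fermionSpinDot,
    d4Emb_pt, smul_eq_mul, Complex.add_re]
  push_cast
  rw [show (-1/6 : ℂ) = ((-1/6 : ℝ) : ℂ) by norm_num, show (-24/81 : ℂ) = ((-24/81 : ℝ) : ℂ) by norm_num,
    show (16/81 : ℂ) = ((16/81 : ℝ) : ℂ) by norm_num, show (12/81 : ℂ) = ((12/81 : ℝ) : ℂ) by norm_num,
    show (-16/81 : ℂ) = ((-16/81 : ℝ) : ℂ) by norm_num, show (4/81 : ℂ) = ((4/81 : ℝ) : ℂ) by norm_num]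
  simp only [Complex.re_ofReal_mul, re_expect_nAt_mul_nAt_eq_docc hω, re_expect_fermionSpinDot_eq_spinCorr hω,
    PolySite.ofLex_coe_pt, d4Vec_zero, add_zero, sub_zero]
  ring

/-- The unsigned twin: `Re ω(Γ(γ)·spinBox3Word) = −(1/6)·docc + (24/81)·C_ω(γ(1,0)) + … + (4/81)·C_ω(γ(2,2))`.
[folklore] -/
theorem re_expect_d4_spinBox3Word (hω : ω.IsTranslationInvariant) (g : DihedralGroup 4) :
    (ω.expect (d4ShiftSet g 0 box3ClassSupport)
        (fermionEmbed (PolySite.d4Emb g 0 box3ClassSupport) spinBox3Word)).re =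
      -(1/6) * docc ω + 24/81 * Certificates.spinCorr ω (d4Vec g ![1, 0])
        + 16/81 * Certificates.spinCorr ω (d4Vec g ![1, 1]) + 12/81 * Certificates.spinCorr ω (d4Vec g ![2, 0])
        + 16/81 * Certificates.spinCorr ω (d4Vec g ![2, 1]) + 4/81 * Certificates.spinCorr ω (d4Vec g ![2, 2]) := by
  unfold spinBox3Word
  simp only [spinDotAt, nAt, map_add, map_smul, map_mul, fermionEmbed_numberOp, fermionEmbed_fermionSpinDot,
    d4Emb_pt, smul_eq_mul, Complex.add_re]
  push_cast
  rw [show (-1/6 : ℂ) = ((-1/6 : ℝ) : ℂ) by norm_num, show (24/81 : ℂ) = ((24/81 : ℝ) : ℂ) by norm_num,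
    show (16/81 : ℂ) = ((16/81 : ℝ) : ℂ) by norm_num, show (12/81 : ℂ) = ((12/81 : ℝ) : ℂ) by norm_num,
    show (4/81 : ℂ) = ((4/81 : ℝ) : ℂ) by norm_num]
  simp only [Complex.re_ofReal_mul, re_expect_nAt_mul_nAt_eq_docc hω, re_expect_fermionSpinDot_eq_spinCorr hω,
    PolySite.ofLex_coe_pt, d4Vec_zero, add_zero, sub_zero]
  ring

/-- **Dictionary, staggered word**: an orbit-mean UPPER bound `(1/8)Σ_γ Re ω(Γ(γ)·spinBoxStag3Word) ≤ q` gives the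
class form of `BoxRowBraggCeilings` bounded by `7/96 + q` (the constant `7/96 = (9/81)·¾·(7/8)` restored; density `7/8`).
[folklore] -/
theorem boxStag3_classForm_le_of_orbitRow (hω : ω.IsTranslationInvariant) {q : ℝ}
    (h : ((Finset.univ : Finset (DihedralGroup 4)).card : ℝ)⁻¹ *
        ∑ g ∈ (Finset.univ : Finset (DihedralGroup 4)), (ω.expect (d4ShiftSet g 0 box3ClassSupport)
          (fermionEmbed (PolySite.d4Emb g 0 box3ClassSupport) spinBoxStag3Word)).re ≤ q) :
    (9 * (3/4 * (7/8 - 2 * docc ω))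
        - 24 * ((8 : ℝ)⁻¹ * ∑ g : DihedralGroup 4, Certificates.spinCorr ω (d4Vec g ![1, 0]))
        + 16 * ((8 : ℝ)⁻¹ * ∑ g : DihedralGroup 4, Certificates.spinCorr ω (d4Vec g ![1, 1]))
        + 12 * ((8 : ℝ)⁻¹ * ∑ g : DihedralGroup 4, Certificates.spinCorr ω (d4Vec g ![2, 0]))
        - 16 * ((8 : ℝ)⁻¹ * ∑ g : DihedralGroup 4, Certificates.spinCorr ω (d4Vec g ![2, 1]))
        + 4 * ((8 : ℝ)⁻¹ * ∑ g : DihedralGroup 4, Certificates.spinCorr ω (d4Vec g ![2, 2]))) / 81 ≤ 7/96 + q := by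
  simp only [re_expect_d4_spinBoxStag3Word hω, Finset.sum_add_distrib, Finset.sum_sub_distrib, Finset.sum_const,
    Finset.card_univ, DihedralGroup.card, nsmul_eq_mul, ← Finset.mul_sum] at h
  push_cast at h
  linarith

/-- **Dictionary, unsigned word**: the same for `spinBox3Word`. [folklore] -/
theorem box3_classForm_le_of_orbitRow (hω : ω.IsTranslationInvariant) {q : ℝ}
    (h : ((Finset.univ : Finset (DihedralGroup 4)).card : ℝ)⁻¹ *
        ∑ g ∈ (Finset.univ : Finset (DihedralGroup 4)), (ω.expect (d4ShiftSet g 0 box3ClassSupport)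
          (fermionEmbed (PolySite.d4Emb g 0 box3ClassSupport) spinBox3Word)).re ≤ q) :
    (9 * (3/4 * (7/8 - 2 * docc ω))
        + 24 * ((8 : ℝ)⁻¹ * ∑ g : DihedralGroup 4, Certificates.spinCorr ω (d4Vec g ![1, 0]))
        + 16 * ((8 : ℝ)⁻¹ * ∑ g : DihedralGroup 4, Certificates.spinCorr ω (d4Vec g ![1, 1]))
        + 12 * ((8 : ℝ)⁻¹ * ∑ g : DihedralGroup 4, Certificates.spinCorr ω (d4Vec g ![2, 0]))
        + 16 * ((8 : ℝ)⁻¹ * ∑ g : DihedralGroup 4, Certificates.spinCorr ω (d4Vec g ![2, 1]))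
        + 4 * ((8 : ℝ)⁻¹ * ∑ g : DihedralGroup 4, Certificates.spinCorr ω (d4Vec g ![2, 2]))) / 81 ≤ 7/96 + q := by
  simp only [re_expect_d4_spinBox3Word hω, Finset.sum_add_distrib, Finset.sum_const,
    Finset.card_univ, DihedralGroup.card, nsmul_eq_mul, ← Finset.mul_sum] at h
  push_cast at h
  linarith

/-- `Re ω(Γ(γ)·spinBox32StagWord)` in the correlators (translation-invariant `ω`). [folklore] -/
theorem re_expect_d4_spinBox32StagWord (hω : ω.IsTranslationInvariant) (g : DihedralGroup 4) :
    (ω.expect (d4ShiftSet g 0 box3ClassSupport)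
        (fermionEmbed (PolySite.d4Emb g 0 box3ClassSupport) spinBox32StagWord)).re =
      -(1/4) * docc ω - 7/18 * Certificates.spinCorr ω (d4Vec g ![1, 0])
        + 2/9 * Certificates.spinCorr ω (d4Vec g ![1, 1]) + 1/9 * Certificates.spinCorr ω (d4Vec g ![2, 0])
        - 1/9 * Certificates.spinCorr ω (d4Vec g ![2, 1]) := by
  unfold spinBox32StagWord
  simp only [spinDotAt, nAt, map_add, map_smul, map_mul, fermionEmbed_numberOp, fermionEmbed_fermionSpinDot,
    d4Emb_pt, smul_eq_mul, Complex.add_re]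
  push_cast
  rw [show (-1/4 : ℂ) = ((-1/4 : ℝ) : ℂ) by norm_num, show (-7/18 : ℂ) = ((-7/18 : ℝ) : ℂ) by norm_num,
    show (2/9 : ℂ) = ((2/9 : ℝ) : ℂ) by norm_num, show (1/9 : ℂ) = ((1/9 : ℝ) : ℂ) by norm_num,
    show (-1/9 : ℂ) = ((-1/9 : ℝ) : ℂ) by norm_num]
  simp only [Complex.re_ofReal_mul, re_expect_nAt_mul_nAt_eq_docc hω, re_expect_fermionSpinDot_eq_spinCorr hω,
    PolySite.ofLex_coe_pt, d4Vec_zero, add_zero, sub_zero]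
  ring

/-- **Dictionary, `3 × 2` staggered word**: an orbit-mean UPPER bound `≤ q` on `spinBox32StagWord` for a translation-invariant `ω`
of density `7/8` bounds the `3 × 2 ⊕ 2 × 3` class form (in `Re spinOrbitCorr ω`) by `7/64 + q`. [folklore] -/
theorem box32Stag_classForm_le_of_orbitRow (hω : ω.IsTranslationInvariant) (hn : ω.density = 7/8) {q : ℝ}
    (h : ((Finset.univ : Finset (DihedralGroup 4)).card : ℝ)⁻¹ *
        ∑ g ∈ (Finset.univ : Finset (DihedralGroup 4)), (ω.expect (d4ShiftSet g 0 box3ClassSupport)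
          (fermionEmbed (PolySite.d4Emb g 0 box3ClassSupport) spinBox32StagWord)).re ≤ q) :
    (6 * (spinOrbitCorr ω ![0, 0]).re - 14 * (spinOrbitCorr ω ![1, 0]).re + 8 * (spinOrbitCorr ω ![1, 1]).re
        + 4 * (spinOrbitCorr ω ![2, 0]).re - 4 * (spinOrbitCorr ω ![2, 1]).re) / 36 ≤ 7/64 + q := by
  simp only [re_expect_d4_spinBox32StagWord hω, Finset.sum_add_distrib, Finset.sum_sub_distrib, Finset.sum_const,
    Finset.card_univ, DihedralGroup.card, nsmul_eq_mul, ← Finset.mul_sum] at h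
  rw [spinOrbitCorr_re_zero hω hn, spinOrbitCorr_re ω ![1, 0], spinOrbitCorr_re ω ![1, 1], spinOrbitCorr_re ω ![2, 0],
    spinOrbitCorr_re ω ![2, 1]]
  push_cast at h
  linarith

end Dictionary

/-! ## §3  Orbit row ⇒ ceiling, and the leaf shape -/

section Leaves

/-- **LEAF (controls, Néel channel).**  `M3ObsNeelCeilingAt t′ c`: for every torus limit `ω` of unit
`(rectN (7/8) L, S^z = 0)`-sector ground states of `hubbardTorusTT' L 1 t′ 8` along `L → ∞` and every finite measure
`μ` on `ℝ²` representing the `D₄`-orbit-mean spin correlation `spinOrbitCorr ω`, the Néel Bragg weight satisfies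
`μ((π,π) + 2πℤ²) ≤ c` — "the squared staggered magnetisation per site of every (translation-averaged) ground state of
the 2D Hubbard model at `(U, n, t′) = (8, 7/8, t′)` is at most `c`".  A closed `Prop`, a CEILING (context row of the
controls menu, not a rung target); non-vacuous (`spinOrbitCorr_representable`). [cite: Scalapino1995, §2] -/
def M3ObsNeelCeilingAt (tp : ℝ) (c : ℝ) : Prop :=
  ∀ (ω : InfVolFermionState 2) (Ls : ℕ → ℕ) (ψ : ∀ L, Fock (Orb (FermionTorus 2 L))),
    Tendsto Ls atTop atTop →
    (∀ j, IsGroundStateInSector (hubbardTorusTT' (Ls j) 1 tp 8) (rectN (7/8) (Ls j)) 0 (ψ (Ls j))) →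
    (∀ j, star (ψ (Ls j)) ⬝ᵥ ψ (Ls j) = 1) → ω.IsTorusLimitOf ψ Ls →
    ∀ (μ : Measure (EuclideanSpace ℝ (Fin 2))), IsFiniteMeasure μ →
      (∀ r : Site 2, ∫ ξ, exp ((∑ i, (r i : ℝ) * ξ i : ℝ) * I) ∂μ = spinOrbitCorr ω r) →
      braggWeight μ ![![π, π]] ≤ c

/-- **LEAF (controls, uniform channel).**  `M3ObsUniformSpinCeilingAt t′ c`: same class of states and measures, the
`q = 0` spin Bragg weight (squared uniform magnetisation per site, the ferromagnetic order parameter) is `≤ c`.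
A CEILING. [cite: Scalapino1995, §2] -/
def M3ObsUniformSpinCeilingAt (tp : ℝ) (c : ℝ) : Prop :=
  ∀ (ω : InfVolFermionState 2) (Ls : ℕ → ℕ) (ψ : ∀ L, Fock (Orb (FermionTorus 2 L))),
    Tendsto Ls atTop atTop →
    (∀ j, IsGroundStateInSector (hubbardTorusTT' (Ls j) 1 tp 8) (rectN (7/8) (Ls j)) 0 (ψ (Ls j))) →
    (∀ j, star (ψ (Ls j)) ⬝ᵥ ψ (Ls j) = 1) → ω.IsTorusLimitOf ψ Ls →
    ∀ (μ : Measure (EuclideanSpace ℝ (Fin 2))), IsFiniteMeasure μ →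
      (∀ r : Site 2, ∫ ξ, exp ((∑ i, (r i : ℝ) * ξ i : ℝ) * I) ∂μ = spinOrbitCorr ω r) →
      braggWeight μ ![(0 : Fin 2 → ℝ)] ≤ c

/-- Monotonicity of the Néel leaf in the ceiling. [folklore] -/
theorem M3ObsNeelCeilingAt.mono {tp c c' : ℝ} (h : M3ObsNeelCeilingAt tp c) (hc : c ≤ c') :
    M3ObsNeelCeilingAt tp c' :=
  fun ω Ls ψ hLs hψ hψ1 hlim μ hfin hμ => (h ω Ls ψ hLs hψ hψ1 hlim μ hfin hμ).trans hc

/-- Monotonicity of the uniform leaf in the ceiling. [folklore] -/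
theorem M3ObsUniformSpinCeilingAt.mono {tp c c' : ℝ} (h : M3ObsUniformSpinCeilingAt tp c) (hc : c ≤ c') :
    M3ObsUniformSpinCeilingAt tp c' :=
  fun ω Ls ψ hLs hψ hψ1 hlim μ hfin hμ => (h ω Ls ψ hLs hψ hψ1 hlim μ hfin hμ).trans hc

/-- **Orbit row ⇒ Néel ceiling.**  A `D₄`-reduced certificate on the staggered box word, typed as the orbit-mean LOWER
cell `M3CorrOrbitLowerRow t′ u r univ box3ClassSupport (−spinBoxStag3Word)` (i.e. `F_s3_stag − 7/96 ≤ −r` in orbit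
mean, GIVEN `e₀(8, 7/8, t′) ≤ u`), together with the window node `M3EnergyUpperRow t′ u`, yields
`M3ObsNeelCeilingAt t′ (7/96 − r)`: the Néel weight of every torus-limit ground state of the class is `≤ 7/96 − r`.
[cite: Scalapino1995, §2] -/
theorem M3ObsNeelCeilingAt_of_spinBoxStag3_orbitRow {tp : ℝ} {u r : ℚ}
    (hrow : M3CorrOrbitLowerRow tp u r Finset.univ box3ClassSupport (-spinBoxStag3Word))
    (hE : M3EnergyUpperRow tp u) :
    M3ObsNeelCeilingAt tp (7/96 - r) := by
  intro ω Ls ψ hLs hψ hψ1 hlim μ hfin hμ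
  obtain ⟨hω, -⟩ := m3_rowState_invariances hLs hψ hψ1 hlim
  have h := hrow ω Ls ψ hLs hψ hψ1 hlim hE
  simp only [map_neg, Complex.neg_re, Finset.sum_neg_distrib, mul_neg] at h
  have h' := boxStag3_classForm_le_of_orbitRow hω (le_neg.1 h)
  refine neel_braggWeight_le_of_boxStag3_classRow ω μ Ls ψ hLs hψ hψ1 hlim ?_ hμ
  linarith

/-- **Orbit row ⇒ uniform-magnetisation ceiling** (unsigned word): `M3CorrOrbitLowerRow t′ u r univ box3ClassSupport
(−spinBox3Word)` and `M3EnergyUpperRow t′ u` yield `M3ObsUniformSpinCeilingAt t′ (7/96 − r)`. [cite: Scalapino1995, §2] -/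
theorem M3ObsUniformSpinCeilingAt_of_spinBox3_orbitRow {tp : ℝ} {u r : ℚ}
    (hrow : M3CorrOrbitLowerRow tp u r Finset.univ box3ClassSupport (-spinBox3Word))
    (hE : M3EnergyUpperRow tp u) :
    M3ObsUniformSpinCeilingAt tp (7/96 - r) := by
  intro ω Ls ψ hLs hψ hψ1 hlim μ hfin hμ
  obtain ⟨hω, -⟩ := m3_rowState_invariances hLs hψ hψ1 hlim
  have h := hrow ω Ls ψ hLs hψ hψ1 hlim hE
  simp only [map_neg, Complex.neg_re, Finset.sum_neg_distrib, mul_neg] at h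
  have h' := box3_classForm_le_of_orbitRow hω (le_neg.1 h)
  refine uniformSpin_braggWeight_le_of_box3_classRow ω μ Ls ψ hLs hψ hψ1 hlim ?_ hμ
  linarith

/-- **Orbit row ⇒ Néel ceiling, `3 × 2` fallback word**: `M3CorrOrbitLowerRow t′ u r univ box3ClassSupport (−spinBox32StagWord)`
and `M3EnergyUpperRow t′ u` yield `M3ObsNeelCeilingAt t′ (7/64 − r)`. [cite: Scalapino1995, §2] -/
theorem M3ObsNeelCeilingAt_of_spinBox32Stag_orbitRow {tp : ℝ} {u r : ℚ}
    (hrow : M3CorrOrbitLowerRow tp u r Finset.univ box3ClassSupport (-spinBox32StagWord))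
    (hE : M3EnergyUpperRow tp u) :
    M3ObsNeelCeilingAt tp (7/64 - r) := by
  intro ω Ls ψ hLs hψ hψ1 hlim μ hfin hμ
  obtain ⟨hω, hn⟩ := m3_rowState_invariances hLs hψ hψ1 hlim
  have h := hrow ω Ls ψ hLs hψ hψ1 hlim hE
  simp only [map_neg, Complex.neg_re, Finset.sum_neg_distrib, mul_neg] at h
  have h' := box32Stag_classForm_le_of_orbitRow hω hn (le_neg.1 h)
  have hb := neel_braggWeight_le_box32sym μ ω hμ
  linarith

/-- **The Néel leaf is ALREADY closed at the plaquette-kernel ceilings of record** (re-export, not a new bound):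
`t′ = −1/4`, rows #259 (spin functional `G_s`, w = 3) + #93 (window) give `M3ObsNeelCeilingAt (−1/4) 0.3399425`
(`neel_r259_instance`). [cite: Scalapino1995, §2] -/
theorem M3ObsNeelCeilingAt_tpm1o4_of_r259 (hup : cert_r259_hubSQ_w3_U8_n7o8_tpm1o4_R2b4eom_ob5p2_LROSup)
    (hE : cert_r93_luc_ti_upper_tpm1o4_n7o8) : M3ObsNeelCeilingAt (-1/4) 0.3399425 :=
  fun ω Ls ψ hLs hψ hψ1 hlim μ _ hμ => neel_r259_instance hup hE ω Ls ψ hLs hψ hψ1 hlim μ hμ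

/-- `t′ = 0`: rows #263 + #92 give `M3ObsNeelCeilingAt 0 0.3360872` (`neel_r263_instance`). [cite: Scalapino1995, §2] -/
theorem M3ObsNeelCeilingAt_tp0_of_r263 (hup : cert_r263_hubSQ_w3_U8_n7o8_R2b4eom_ob5p2_LROSup)
    (hE : cert_r92_luc_ti_upper_tp0_n7o8) : M3ObsNeelCeilingAt 0 0.3360872 :=
  fun ω Ls ψ hLs hψ hψ1 hlim μ _ hμ => neel_r263_instance hup hE ω Ls ψ hLs hψ hψ1 hlim μ hμ

/-- **Non-vacuity**: the states of the leaves HAVE representing measures (`rowState_representable`), so the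
`∀ μ` in the leaves quantifies over a nonempty family. [folklore] -/
theorem M3ObsNeelCeilingAt_nonvacuous {tp : ℝ} (ω : InfVolFermionState 2) {Ls : ℕ → ℕ}
    {ψ : ∀ L, Fock (Orb (FermionTorus 2 L))} (hLs : Tendsto Ls atTop atTop)
    (hψ : ∀ j, IsGroundStateInSector (hubbardTorusTT' (Ls j) 1 tp 8) (rectN (7/8) (Ls j)) 0 (ψ (Ls j)))
    (hψ1 : ∀ j, star (ψ (Ls j)) ⬝ᵥ ψ (Ls j) = 1) (hlim : ω.IsTorusLimitOf ψ Ls) :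
    ∃ μ : Measure (EuclideanSpace ℝ (Fin 2)), IsFiniteMeasure μ ∧
      ∀ r : Site 2, ∫ ξ, exp ((∑ i, (r i : ℝ) * ξ i : ℝ) * I) ∂μ = spinOrbitCorr ω r :=
  (rowState_representable ω hLs hψ hψ1 hlim).2

end Leaves

end Summit.Ventures.CertifiedManyBodySolver.Observables

end
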